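import Mathlib
import Summits.ValiantsHypothesis.ValiantsHypothesis.Theorems.GeneratorObstructionsPowGenDegreeQPTableauBridge

/-!
# Route GeneratorObstructions — crux K2 `PowGenDegreeQP` (stmt-ValiantsHypothesis-11655), line
# `trace-side-regimes`: the value of a tableau polynomial at the doubling gadget is a signed count

Companion of `…PowGenDegreeQPTableauBridge` (closed form `aeval_formCoeff_tabPoly_eq_sum`) and of the
blueprint (evidence memo `evidence-11655-leafhand3-g5.md`).  For the doubling gadget
`g = Σ_{j<c} x_{B j}^k x_{A j}^{2k} x_{A' j}^{2k}` on pairwise distinct letters: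

* `coeff_gadget` — its coefficients: `coeff_d g = 1` if `d` is one of the `c` gadget exponent vectors
  `gadgetExp j = k·e_{B j} + 2k·e_{A j} + 2k·e_{A' j}`, else `0` (the monomials are distinct);
* `ffact_gadgetExp` — `(gadgetExp j)! = k! (2k)! (2k)!`;
* `aeval_formCoeff_tabPoly_gadget` — **for ANY tableau datum `τ`, the value of its tableau polynomial
  at `g` is `(k!(2k)!(2k)!)^d · Σ_π (∏_c sign π_c) · [every label's content under π is a gadget
  exponent vector]`** — a pure signed count of "valid" column rearrangements.

So the GIT input of `not_powGenDegreeQP_of_canonicalGadgetGIT_pow` (via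
`exists_hwv_evalAtPoint_ne_zero_of_tabPoly`) is reduced to exhibiting a framed tableau datum on the
top letters whose valid signed count is nonzero; the blueprint's datum has count
`blockSum(k)^{2^c-1}` (`…BlockCountGen/Eval`: `blockSum (2^t) ≠ 0`).

Honest framing: plumbing; no stub, crux or summit is settled here; `VP ≠ VNP` untouched. [folklore]
-/

namespace Summit.ValiantsHypothesis.ValiantsHypothesis.Theorems.GeneratorObstructions.PowGenDegreeQP

open MvPolynomial
open Literature.NumberTheory.DiophantineGeometry Literature.Computability.AlgebraicComplexity
  Literature.Computability.AlgebraicComplexity.TableauEval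

-- `Summit.ValiantsHypothesis.ValiantsHypothesis.…` is the tree's mandated single-conjunct layout.
set_option linter.dupNamespace false

noncomputable section

variable {σ : Type*}

/-- The exponent vector of the `j`-th gadget monomial `x_{B j}^k x_{A j}^{2k} x_{A' j}^{2k}`. [folklore] -/
def gadgetExp {c : ℕ} (k : ℕ) (B A A' : Fin c → σ) (j : Fin c) : σ →₀ ℕ :=
  Finsupp.single (B j) k + Finsupp.single (A j) (2 * k) + Finsupp.single (A' j) (2 * k)

/-- A gadget monomial is the monomial of its exponent vector. [folklore] -/
theorem gadgetMonomial_eq {c : ℕ} (k : ℕ) (B A A' : Fin c → σ) (j : Fin c) :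
    (X (B j) ^ k * (X (A j) ^ (2 * k) * X (A' j) ^ (2 * k)) : MvPolynomial σ ℂ) =
      monomial (gadgetExp k B A A' j) 1 := by
  rw [X_pow_eq_monomial, X_pow_eq_monomial, X_pow_eq_monomial, monomial_mul, monomial_mul, mul_one,
    mul_one, gadgetExp, add_assoc]

/-- The value of `gadgetExp j` at the letter `B i` is `k · [i = j]` (letters pairwise distinct).
[folklore] -/
theorem gadgetExp_apply_B {c : ℕ} (k : ℕ) {B A A' : Fin c → σ} (hB : Function.Injective B)
    (hBA : ∀ i j, B i ≠ A j) (hBA' : ∀ i j, B i ≠ A' j) (i j : Fin c) :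
    gadgetExp k B A A' j (B i) = if i = j then k else 0 := by
  classical
  simp only [gadgetExp, Finsupp.coe_add, Pi.add_apply, Finsupp.single_apply]
  rw [if_neg (hBA i j).symm, if_neg (hBA' i j).symm, add_zero, add_zero]
  by_cases h : i = j
  · subst h; simp
  · rw [if_neg (fun h' => h (hB h').symm), if_neg h]

/-- Distinct blocks have distinct exponent vectors (`k ≥ 1`). [folklore] -/
theorem gadgetExp_injective {c : ℕ} {k : ℕ} (hk : 1 ≤ k) {B A A' : Fin c → σ}
    (hB : Function.Injective B) (hBA : ∀ i j, B i ≠ A j) (hBA' : ∀ i j, B i ≠ A' j) :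
    Function.Injective (gadgetExp k B A A') := by
  intro i j h
  have h' : gadgetExp k B A A' i (B i) = gadgetExp k B A A' j (B i) := by rw [h]
  rw [gadgetExp_apply_B k hB hBA hBA', gadgetExp_apply_B k hB hBA hBA', if_pos rfl] at h'
  by_contra hne
  rw [if_neg hne] at h'
  omega

/-- **Coefficients of the gadget**: `coeff_d g = [d ∈ {gadgetExp j}]`. [folklore] -/
theorem coeff_gadget [DecidableEq σ] {c : ℕ} {k : ℕ} (hk : 1 ≤ k) {B A A' : Fin c → σ}
    (hB : Function.Injective B) (hBA : ∀ i j, B i ≠ A j) (hBA' : ∀ i j, B i ≠ A' j) (d : σ →₀ ℕ) :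
    coeff d (∑ j : Fin c, (X (B j) ^ k * (X (A j) ^ (2 * k) * X (A' j) ^ (2 * k)) :
      MvPolynomial σ ℂ)) = if ∃ j, d = gadgetExp k B A A' j then 1 else 0 := by
  simp_rw [gadgetMonomial_eq, coeff_sum, coeff_monomial]
  by_cases h : ∃ j, d = gadgetExp k B A A' j
  · obtain ⟨j, rfl⟩ := h
    rw [if_pos ⟨j, rfl⟩, Finset.sum_eq_single j]
    · rw [if_pos rfl]
    · intro i _ hij
      rw [if_neg (fun h => hij (gadgetExp_injective hk hB hBA hBA' h))]
    · intro hj; exact absurd (Finset.mem_univ j) hj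
  · rw [if_neg h]
    refine Finset.sum_eq_zero fun j _ => ?_
    rw [if_neg (fun h' => h ⟨j, h'.symm⟩)]

/-- `(gadgetExp j)! = k! (2k)! (2k)!` (letters pairwise distinct). [folklore] -/
theorem ffact_gadgetExp {c : ℕ} (k : ℕ) {B A A' : Fin c → σ}
    (hBA : ∀ i j, B i ≠ A j) (hBA' : ∀ i j, B i ≠ A' j) (hAA' : ∀ i j, A i ≠ A' j) (j : Fin c) :
    ffact (gadgetExp k B A A' j) = k.factorial * (2 * k).factorial * (2 * k).factorial := by
  classical
  unfold ffact gadgetExp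
  have h0 : ∀ a : σ, (fun (_ : σ) (n : ℕ) => n.factorial) a 0 = 1 := fun _ => Nat.factorial_zero
  have hd1 : Disjoint (Finsupp.single (B j) k + Finsupp.single (A j) (2 * k)).support
      (Finsupp.single (A' j) (2 * k)).support := by
    refine Finset.disjoint_of_subset_left Finsupp.support_add ?_
    refine Finset.disjoint_of_subset_right Finsupp.support_single_subset ?_
    rw [Finset.disjoint_singleton_right, Finset.mem_union, not_or]
    exact ⟨fun h => hBA' j j (Finset.mem_singleton.mp (Finsupp.support_single_subset h)).symm,
      fun h => hAA' j j (Finset.mem_singleton.mp (Finsupp.support_single_subset h)).symm⟩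
  have hd2 : Disjoint (Finsupp.single (B j) k).support (Finsupp.single (A j) (2 * k)).support := by
    refine Finset.disjoint_of_subset_left Finsupp.support_single_subset
      (Finset.disjoint_of_subset_right Finsupp.support_single_subset ?_)
    rw [Finset.disjoint_singleton_right, Finset.mem_singleton]
    exact fun h => hBA j j h.symm
  rw [Finsupp.prod_add_index_of_disjoint hd1 (fun (_ : σ) (n : ℕ) => n.factorial),
    Finsupp.prod_add_index_of_disjoint hd2 (fun (_ : σ) (n : ℕ) => n.factorial),
    Finsupp.prod_single_index (h0 (B j)), Finsupp.prod_single_index (h0 (A j)),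
    Finsupp.prod_single_index (h0 (A' j))]

/-- **The value of any tableau polynomial at the doubling gadget is a signed count**: for a tableau
datum `τ` (any shape, `τ.m` boxes per label) and the gadget `g` on pairwise distinct letters
(`k ≥ 1`), `F_τ(g) = (k!(2k)!(2k)!)^d · Σ_π (∏_c sign π_c) · [∀ u, ∃ j, α_u(π) = gadgetExp j]`.
[folklore] -/
theorem aeval_formCoeff_tabPoly_gadget [Fintype σ] [LinearOrder σ] (τ : TabM σ) {c k : ℕ} (hk : 1 ≤ k)
    {B A A' : Fin c → σ}
    (hB : Function.Injective B) (hBA : ∀ i j, B i ≠ A j) (hBA' : ∀ i j, B i ≠ A' j)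
    (hAA' : ∀ i j, A i ≠ A' j) :
    aeval (formCoeff τ.m (∑ j : Fin c, (X (B j) ^ k * (X (A j) ^ (2 * k) * X (A' j) ^ (2 * k)) :
      MvPolynomial σ ℂ))) (τ.tabPoly ℂ) =
      ((k.factorial * (2 * k).factorial * (2 * k).factorial : ℕ) : ℂ) ^ τ.d *
        ∑ π : τ.Bij, ((τ.sgnProd π : ℤ) : ℂ) *
          (if ∀ u, ∃ j, τ.content π u = gadgetExp k B A A' j then 1 else 0) := by
  classical
  rw [aeval_formCoeff_tabPoly_eq_sum, Finset.mul_sum]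
  refine Finset.sum_congr rfl fun π _ => ?_
  simp_rw [coeff_gadget hk hB hBA hBA']
  by_cases hval : ∀ u, ∃ j, τ.content π u = gadgetExp k B A A' j
  · rw [if_pos hval]
    have hprod : ∏ u, ((ffact (τ.content π u) : ℂ) *
        (if ∃ j, τ.content π u = gadgetExp k B A A' j then 1 else 0)) =
        ((k.factorial * (2 * k).factorial * (2 * k).factorial : ℕ) : ℂ) ^ τ.d := by
      rw [Finset.prod_congr rfl (g := fun _ =>
          ((k.factorial * (2 * k).factorial * (2 * k).factorial : ℕ) : ℂ)) ?_,
        Finset.prod_const, Finset.card_univ, Fintype.card_fin]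
      intro u _
      obtain ⟨j, hj⟩ := hval u
      rw [if_pos ⟨j, hj⟩, mul_one, hj, ffact_gadgetExp k hBA hBA' hAA' j]
    rw [hprod]
    ring
  · rw [if_neg hval, mul_zero, mul_zero]
    obtain ⟨u, hu⟩ := not_forall.mp hval
    apply mul_eq_zero_of_right
    apply Finset.prod_eq_zero (Finset.mem_univ u)
    rw [if_neg hu, mul_zero]

end

end Summit.ValiantsHypothesis.ValiantsHypothesis.Theorems.GeneratorObstructions.PowGenDegreeQP
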